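import Summits.KontsevichZagierPeriods.KontsevichZagierPeriods.Statement
import Literature.NumberTheory.Transcendental.KZCalculusProofs

/-!
# KontsevichZagierPeriods — the summit implies every rung of the dimension ladder (on-path lemma)

Cell pub-kz1p (paper "KZ 1-periods", seat b2b-kz1p-1).  The DIMENSION LADDER (seat free-KontsevichZagierPeriods-1,
ideation tier, 2026-08-17): `KZ_≤d` := "two integral representations of dimensions `≤ d` (ℚ-semialgebraic integrands,
`KZ.IntegralRep`) with the same value are `KZ.Equivalent`".  This file records the trivial but mandatory ON-PATH
direction: the summit statement `KontsevichZagierPeriods` (= `Literature.Periods.KZPeriodConjecture`, KZ-literal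
rational representations) implies `KZ_≤d` for every `d` and for ALL semialgebraic representations — because every
representation is KZ-equivalent to a rational-shape one (`KZ.exists_isRational_equivalent_holds`, Tarski–Seidenberg +
graph trick, kernel-proved in `KZCalculusProofs.lean`) and equivalent representations have equal values (soundness,
`KZ.Equivalent.value_eq_holds`).  In particular `KZ_≤1` (rung 1, the cell's subject) and the tree's open crux
`LowDimension.PlanarAreas` (a special case of `KZ_≤2`) are consequences of the summit, i.e. genuinely on the path.

The rung statements are written out in full (the cell's package `kzoneperiods` is not part of the tree).
Sources: M. Kontsevich, D. Zagier, *Periods* (2001), §1.1 (remark after the Definition), §1.2 Conjecture 1 and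
Problem 2 ("dimension"). [cite: KontsevichZagier2001, §1.2]
-/

namespace Summit.KontsevichZagierPeriods.KzOnePeriods

open Literature.NumberTheory.Transcendental
open Literature.NumberTheory.Transcendental.KZ

/-- **The summit implies rung `d` for all semialgebraic representations**: if `KontsevichZagierPeriods` holds then any
two integral representations of dimensions `≤ d` with equal values are KZ-equivalent.  (Rational-shape detour:
`exists_isRational_equivalent_holds`, soundness `Equivalent.value_eq_holds`, transitivity.)
[Kontsevich–Zagier 2001, §1.1–1.2] [cite: KontsevichZagier2001, §1.2] -/
theorem kz_le_of_summit (h : _root_.KontsevichZagierPeriods) (d : ℕ) :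
    ∀ ⦃n m : ℕ⦄, n ≤ d → m ≤ d → ∀ (r : IntegralRep n) (r' : IntegralRep m),
      r.value = r'.value → Equivalent r r' := by
  intro n m _ _ r r' hv
  have h' := (_root_.KontsevichZagierPeriods_iff).1 h
  obtain ⟨k, R, hR, hrR⟩ := exists_isRational_equivalent_holds r
  obtain ⟨k', R', hR', hrR'⟩ := exists_isRational_equivalent_holds r'
  have hvR : R.value = R'.value := by
    rw [← Equivalent.value_eq_holds hrR, ← Equivalent.value_eq_holds hrR', hv]
  exact (hrR.trans (h' R R' hR hR' hvR)).trans hrR'.symm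

/-- **Rung 1 is on the path**: the summit implies `KZ_≤1` (all semialgebraic representations of dimension `≤ 1`).
[Kontsevich–Zagier 2001, §1.2] [cite: KontsevichZagier2001, §1.2] -/
theorem kz_le_one_of_summit (h : _root_.KontsevichZagierPeriods) :
    ∀ ⦃n m : ℕ⦄, n ≤ 1 → m ≤ 1 → ∀ (r : IntegralRep n) (r' : IntegralRep m),
      r.value = r'.value → Equivalent r r' :=
  kz_le_of_summit h 1

/-- **`PlanarAreas` is on the path**: the summit implies the statement of the tree's crux `LowDimension.PlanarAreas`
(item stmt-KontsevichZagierPeriods-4990), written out. [Kontsevich–Zagier 2001, §1.2] [cite: KontsevichZagier2001, §1.2] -/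
theorem planarAreas_of_summit (h : _root_.KontsevichZagierPeriods) :
    ∀ (r r' : IntegralRep 2), (∀ p ∈ r.domain, r.integrand p = 1) → (∀ p ∈ r'.domain, r'.integrand p = 1) →
      r.value = r'.value → Equivalent r r' :=
  fun r r' _ _ hv => kz_le_of_summit h 2 le_rfl le_rfl r r' hv

end Summit.KontsevichZagierPeriods.KzOnePeriods
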